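import Literature.Probability.Percolation.CardyFormula
import Literature.Probability.RandomPlanarGeometry.SelfAvoidingWalk
import Literature.Probability.Percolation.CriticalContinuity
import Literature.Probability.LatticeModels.ScalingLimit3D
import HarnessLib

/-!
# CriticalPhenomena / CardyFormulaZ2 — sub-problem statement (D-0017)

Moved out of `Summits/CriticalPhenomena/Statement.lean` with the declaration text unchanged.
-/

/-- Conjunct `CardyFormulaZ2` of `CriticalPhenomena`: **Cardy's formula for bond percolation on
`ℤ²` at `p = 1/2`** — for every conformal rectangle `(Ω; a, b, c, d)` (bounded Jordan domain,
four marked boundary points in cyclic order), the `P_{1/2}`-probability that the discrete arcs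
`(ab)_δ` and `(cd)_δ` of `Ω_δ ⊆ δℤ²` are joined by an open path of `Ω_δ` tends, as `δ → 0⁺`, to
`F(η)`, `η ∈ (0,1)` the cross-ratio of the boundary preimages of `a, b, c, d` under any conformal
map `ℍ → Ω` and `F = Literature.cardyFunction` (Cardy's hypergeometric function). Smirnov 2001, Thm 1
is the theorem for site percolation on the triangular lattice; its closing remark records the
square-lattice bond case as open — that case is this conjunct. The Literature statement
`Literature.Probability.Percolation.CardyFormulaZ2` (`Literature/Probability/Percolation/CardyFormula.lean`):
`∀ R : ConformalRectangle, R.HasCrossingLimit (bondDomainCrossingProb R) cardyFunction`,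
imported not restated. [cite: Smirnov2001, Thm 1 and closing remark (ℤ² bond case open)]
[cite: Cardy1992, eq. (8)] [problem: crit-perc] -/
abbrev CardyFormulaZ2 : Prop := Literature.Probability.Percolation.CardyFormulaZ2
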